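import Mathlib
import HarnessLib
import Summits.CriticalPhenomena.CardyFormulaZ2.Theses.CardySelfRefinement
import Literature.Probability.RandomPlanarGeometry.ChordalReversibility
import Literature.Probability.RandomPlanarGeometry.ConformalRectangle
import Literature.Probability.RandomPlanarGeometry.IsometryCovariance
import Literature.Probability.Percolation.IkhlefPonsaingFirstPassage
import Literature.Probability.Percolation.HalfPlaneCrossingGluing
import Literature.Probability.Percolation.HalfPlaneArmDiagonalInputs
import Literature.Probability.Percolation.HalfPlaneArmAxisInputs
import Literature.Probability.Percolation.LatticeSymmetry
import Summits.CriticalPhenomena.CardyFormulaZ2.Theorems.CardySelfRefinementSymmetryUpgradeRTouchTwoScaleArm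

/-!
# Steering the two-scale diagonal arm to the wired row: level-`0` gluing and its probability
# (conditional on Ikhlef–Ponsaing, Prop. 4.7)

Helper file for stub `stub_touchExponent` (S3) of line `SketchIdeatorTwo` of crux `SymmetryUpgradeR`
(stmt-CriticalPhenomena-17239, route CardySelfRefinement), helper L2 (`touchExponent_wiredArmLower`),
part 1: the lattice gluing at level `0` of the diagonal half-plane `{hgtOf ≥ 0}` of `ℤ²`
(`col v = v₀ - v₁`, `hgtOf v = v₀ + v₁`).

* `touchExponent_glue0` (deterministic) — on a lattice configuration containing an open crossing
  of the half-annulus `ann[b, r, 2a]` of T3 (`touchExponent_twoScaleArm`; base point `b` on the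
  wall `hgtOf = 0`), open top–bottom crossings of the two pillars
  `{col b + a ≤ col ≤ col b + 2a} × {0 ≤ hgtOf ≤ 2a}`, `{col b - 2a ≤ col ≤ col b - a} × {0 ≤ hgtOf ≤ 2a}`
  and an open left–right crossing of the long bar `{a ≤ col ≤ col b + 2a} × {a ≤ hgtOf ≤ 2a}`, the
  inner end `x` (`ν_b(x) = r`) of the half-annulus crossing is joined, inside
  `{a ≤ col ≤ col b + 2a, 0 ≤ hgtOf ≤ 2a} ∩ {v₁ ≤ -1}`, to a site of the row `v₁ = -1`: the part of
  the long crossing to the right of the column `col b - 2a` is the bar of a U which catches the arm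
  (`HalfPlaneArm.uCatch`, Nolin 2008, §4.3/§4.6), the long crossing continues to the column
  `col = a` where `v₁ ≥ 0`, and the path is clipped at its first visit to the row `v₁ = -1`
  (`exists_openConnIn_le_level`, `HalfPlaneArm.axis_Y_le`). In the application the row `v₁ = -1` is the row of the discrete
  triangle along the wired leg `[-1, 0]`.
* `touchExponent_wiredArmLower_glue` (registered) — the four events happen simultaneously with
  probability `≥ c (r/2a)^{1/3}` for `m₀ ≤ r ≤ a`, `0 ≤ col b + a ≤ 67 a`: T3 (lower half) for the
  half-annulus, RSW at `p = 1/2` in the diagonal orientation for the pillars and the bar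
  (`HalfPlaneArm.tb_lower`, `HalfPlaneArm.lr_lower` with `diag_rswTB`, `diag_rswLR`), Harris–FKG.
-/

noncomputable section

namespace Summit.CriticalPhenomena.CardyFormulaZ2.Theorems.SymmetryUpgradeR.SwallowingSkeleton

open MeasureTheory Filter Set
open Literature.Probability.RandomPlanarGeometry Literature.Probability.LatticeModels
  Literature.Probability.Percolation
open UpperHalfPlane (upperHalfPlaneSet)
open Literature.Probability.Percolation.TrackExchange

local notation3 "ν[" b ", " v "]" => max |col v - col b| (hgtOf v - hgtOf b)
local notation3 "box[" A₁ ", " A₂ ", " B₁ ", " B₂ "]" =>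
  {v : Site 2 | A₁ ≤ col v ∧ col v ≤ A₂ ∧ B₁ ≤ hgtOf v ∧ hgtOf v ≤ B₂}
local notation3 "LR[" A₁ ", " A₂ ", " B₁ ", " B₂ "]" =>
  openCrossing box[A₁, A₂, B₁, B₂] {v : Site 2 | col v = A₁} {v : Site 2 | col v = A₂}
local notation3 "TB[" A₁ ", " A₂ ", " B₁ ", " B₂ "]" =>
  openCrossing box[A₁, A₂, B₁, B₂] {v : Site 2 | hgtOf v = B₁} {v : Site 2 | hgtOf v = B₂}
local notation3 "ann[" b ", " r ", " R "]" =>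
  {v : Site 2 | 0 ≤ hgtOf v ∧ r ≤ ν[b, v] ∧ ν[b, v] ≤ R}
local notation3 "E[" b ", " r ", " R "]" =>
  openCrossing ann[b, r, R] {v : Site 2 | ν[b, v] = r} {v : Site 2 | ν[b, v] = R}
local notation3 "μ" => bondPercolation (zdGraph 2) half

/-! ### Level-0 gluing: the two-scale arm is steered to the row `v₁ = -1` -/

/-- **Deterministic gluing at level `0`.** On a lattice configuration containing an open crossing
of the half-annulus `ann[b, r, 2a]` (base point `b` on the wall `hgtOf = 0`), open top–bottom
crossings of the two pillars `{col b + a ≤ col ≤ col b + 2a} × {0 ≤ hgtOf ≤ 2a}`,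
`{col b - 2a ≤ col ≤ col b - a} × {0 ≤ hgtOf ≤ 2a}` and an open left–right crossing of the long
bar `{a ≤ col ≤ col b + 2a} × {a ≤ hgtOf ≤ 2a}`, the inner end `x` of the half-annulus crossing
(`ν_b(x) = r`) is joined inside `{a ≤ col ≤ col b + 2a, 0 ≤ hgtOf ≤ 2a} ∩ {v₁ ≤ -1}` to a site of
the row `v₁ = -1` (the U catches the arm, `HalfPlaneArm.uCatch`; the bar continues to the column
`col = a`, where `v₁ ≥ 0`; clip at the first visit to the row `v₁ = -1`). -/
theorem touchExponent_glue0 {ω : BondConfig (Site 2)} (hω : ω ⊆ (zdGraph 2).edgeSet)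
    {b : Site 2} (hb : hgtOf b = 0) {r a : ℤ} (ha : 1 ≤ a) (hra : r ≤ a)
    (hab : 3 * a ≤ col b) (hrb : 2 * r + 2 ≤ col b)
    (hE : ω ∈ E[b, r, 2 * a])
    (hR : ω ∈ TB[col b + a, col b + 2 * a, 0, 2 * a])
    (hL : ω ∈ TB[col b - 2 * a, col b - a, 0, 2 * a])
    (hH : ω ∈ LR[a, col b + 2 * a, a, 2 * a]) :
    ∃ x u₀ : Site 2, ν[b, x] = r ∧ 0 ≤ hgtOf x ∧ u₀ 1 = -1 ∧
      ω ∈ openConnIn (box[a, col b + 2 * a, 0, 2 * a] ∩ {v : Site 2 | v 1 ≤ -1}) x u₀ := by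
  obtain ⟨x, hx, y, hy, hxy⟩ := hE
  obtain ⟨hL', hhL', hR', hhR', hHc⟩ := hH
  obtain ⟨xR, hxR, yR, hyR, hRc⟩ := hR
  obtain ⟨xL, hxL, yL, hyL, hLc⟩ := hL
  have hx : ν[b, x] = r := hx
  have hy : ν[b, y] = 2 * a := hy
  have hhL' : col hL' = a := hhL'
  have hhR' : col hR' = col b + 2 * a := hhR'
  have hxR : hgtOf xR = 0 := hxR
  have hyR : hgtOf yR = 2 * a := hyR
  have hxL : hgtOf xL = 0 := hxL
  have hyL : hgtOf yL = 2 * a := hyL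
  -- the bar: the part of the long crossing to the right of the column `col b - 2a`
  obtain ⟨xB, hxB, hbar⟩ := exists_openConnIn_ge_level hω col HalfPlaneArm.diag_X_le
    (col b - 2 * a) (show col hL' ≤ col b - 2 * a by omega) (show col b - 2 * a ≤ col hR' by omega) hHc
  have hbar' : ω ∈ openConnIn box[col b - 2 * a, col b + 2 * a, hgtOf b + a, hgtOf b + 2 * a] xB hR' := by
    rw [hb, zero_add, zero_add]
    refine openConnIn_mono (fun v hv => ?_) _ _ hbar
    obtain ⟨⟨h1, h2, h3, h4⟩, h5⟩ := hv
    have h5 : col b - 2 * a ≤ col v := h5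
    exact ⟨h5, h2, h3, h4⟩
  have hRc' : ω ∈ openConnIn box[col b + a, col b + 2 * a, 0, hgtOf b + 2 * a] xR yR := by
    rw [hb, zero_add]; exact hRc
  have hLc' : ω ∈ openConnIn box[col b - 2 * a, col b - a, 0, hgtOf b + 2 * a] xL yL := by
    rw [hb, zero_add]; exact hLc
  -- the U catches the arm
  have h1 := HalfPlaneArm.uCatch (X := col) (Y := hgtOf) HalfPlaneArm.diag_X_le HalfPlaneArm.diag_Y_le
    (emb := gmEmbedding (fun _ => (0 : ℝ)) (fun _ => Real.pi / 2)) isIsoradial_dia isRhombicTiling_dia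
    (κ := 1) one_pos HalfPlaneArm.diag_re HalfPlaneArm.diag_im hω (b := b) (by rw [hb]) ha hbar' hxB hhR'
    hRc' hxR (by rw [hyR, hb, zero_add]) hLc' hxL (by rw [hyL, hb, zero_add]) (S := ann[b, r, 2 * a])
    (fun v hv => hv.1) hxy (by rw [hx]; exact hra) (by rw [hy])
  -- the left end of the long crossing is joined to the left end of the bar
  have h2 : ω ∈ openConnIn box[a, col b + 2 * a, a, 2 * a] hL' xB :=
    HalfPlaneArm.conn_trans subset_rfl Set.inter_subset_left hHc (HalfPlaneArm.conn_symm hbar)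
  -- everything inside the box `T`
  have hT1 : ann[b, r, 2 * a] ∪ box[col b - 2 * a, col b + 2 * a, 0, hgtOf b + 2 * a] ⊆
      box[a, col b + 2 * a, 0, 2 * a] := by
    rintro v (hv | hv)
    · obtain ⟨h0, -, h2⟩ := hv
      rw [max_le_iff, abs_le, hb] at h2
      exact ⟨by omega, by omega, h0, by omega⟩
    · obtain ⟨h1, h2, h3, h4⟩ := hv
      rw [hb] at h4
      exact ⟨by omega, h2, h3, by omega⟩
  have hT2 : box[a, col b + 2 * a, a, 2 * a] ⊆ box[a, col b + 2 * a, 0, 2 * a] := by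
    rintro v ⟨h1, h2, h3, h4⟩
    exact ⟨h1, h2, by omega, h4⟩
  have h3 : ω ∈ openConnIn box[a, col b + 2 * a, 0, 2 * a] x hL' :=
    HalfPlaneArm.conn_trans hT1 hT2 h1 (HalfPlaneArm.conn_symm h2)
  -- clip at the first visit to the row `v₁ = -1`
  have hx0 : 0 ≤ hgtOf x := hxy.1.1
  have hx1 : x 1 ≤ -1 := by
    have e1 : |col x - col b| ≤ r := by rw [← hx]; exact le_max_left _ _
    have e2 : hgtOf x - hgtOf b ≤ r := by rw [← hx]; exact le_max_right _ _
    rw [abs_le] at e1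
    rw [hb] at e2
    simp only [col, hgtOf] at e1 e2 hrb ⊢
    omega
  have hy1 : -1 ≤ hL' 1 := by
    have e1 : a ≤ hgtOf hL' := h2.1.2.2.1
    simp only [col, hgtOf] at e1 hhL' ⊢
    omega
  obtain ⟨u₀, hu₀, hconn⟩ := exists_openConnIn_le_level hω (fun v : Site 2 => v 1)
    HalfPlaneArm.axis_Y_le (-1) hx1 hy1 h3
  exact ⟨x, u₀, hx, hx0, hu₀, hconn⟩


/-- **`touchExponent_wiredArmLower_glue`** (registered helper for `touchExponent_wiredArmLower` /
`stub_touchExponent`): **the glued event is not too unlikely.** Conditional on Ikhlef–Ponsaing's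
Prop. 4.7: there are `c > 0` and a threshold `m₀ ≥ 1` such that for every base point `b` of the
wall `hgtOf = 0` and all natural scales `m₀ ≤ r ≤ a`, `m₀ ≤ a`, with `0 ≤ col b + a ≤ 67 a`, the
four events of `touchExponent_glue0` — the two-scale arm `E[b, r, 2a]`, the two pillars and the
long bar — happen simultaneously with probability `≥ c (r / 2a)^{1/3}` (T3 for the half-annulus,
RSW for the pillars and the long bar, Harris–FKG). -/
theorem touchExponent_wiredArmLower_glue : Literature.Probability.Percolation.IkhlefPonsaingFirstPassage → ∃ c : ℝ, 0 < c ∧ ∃ m₀ : ℕ, 1 ≤ m₀ ∧ ∀ (b : Site 2) (r a : ℕ), TrackExchange.hgtOf b = 0 → m₀ ≤ r → m₀ ≤ a → r ≤ a → 0 ≤ TrackExchange.col b + a → TrackExchange.col b + a ≤ 67 * a → c * ((r : ℝ) / (2 * a)) ^ (1 / 3 : ℝ) ≤ (bondPercolation (zdGraph 2) half).real (openCrossing {v : Site 2 | 0 ≤ TrackExchange.hgtOf v ∧ (r : ℤ) ≤ max |TrackExchange.col v - TrackExchange.col b| (TrackExchange.hgtOf v - TrackExchange.hgtOf b) ∧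 max |TrackExchange.col v - TrackExchange.col b| (TrackExchange.hgtOf v - TrackExchange.hgtOf b) ≤ 2 * (a : ℤ)} {v : Site 2 | max |TrackExchange.col v - TrackExchange.col b| (TrackExchange.hgtOf v - TrackExchange.hgtOf b) = (r : ℤ)} {v : Site 2 | max |TrackExchange.col v - TrackExchange.col b| (TrackExchange.hgtOf v - TrackExchange.hgtOf b) = 2 * (a : ℤ)} ∩ openCrossing {v : Site 2 | TrackExchange.col b + a ≤ TrackExchange.col v ∧ TrackExchange.col v ≤ TrackExchange.col b + 2 * a ∧ 0 ≤ TrackExchange.hgtOf v ∧ TrackExchange.hgtOf v ≤ 2 * a} {v : Site 2 | TrackExchange.hgtOf v = 0} {v : Site 2 | TrackExchange.hgtOf v = 2 * a} ∩ openCrossing {v : Site 2 | TrackExchange.col b - 2 * a ≤ TrackExchange.col v ∧ TrackExchange.col v ≤ TrackExchange.col b - a ∧ 0 ≤ TrackExchange.hgtOf v ∧ TrackExchange.hgtOf v ≤ 2 * a} {v : Site 2 | TrackExchange.hgtOf v = 0} {v : Site 2 | TrackExchange.hgtOf v = 2 * a} ∩ openCrossing {v : Site 2 | (a : ℤ) ≤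 TrackExchange.col v ∧ TrackExchange.col v ≤ TrackExchange.col b + 2 * a ∧ (a : ℤ) ≤ TrackExchange.hgtOf v ∧ TrackExchange.hgtOf v ≤ 2 * a} {v : Site 2 | TrackExchange.col v = (a : ℤ)} {v : Site 2 | TrackExchange.col v = TrackExchange.col b + 2 * a}) := by
  intro hIP
  obtain ⟨cT, C, hcT, r₀, hr₀, hT⟩ := touchExponent_twoScaleArm hIP
  obtain ⟨c₁, hc₁, m₁, h₁⟩ := HalfPlaneArm.tb_lower (X := col) (Y := hgtOf) HalfPlaneArm.diag_Y_le half
    HalfPlaneArm.diag_rswTB 2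
  obtain ⟨c₂, hc₂, m₂, h₂⟩ := HalfPlaneArm.lr_lower (X := col) (Y := hgtOf) HalfPlaneArm.diag_X_le half
    HalfPlaneArm.diag_rswLR 67
  refine ⟨cT * c₁ * c₁ * c₂, by positivity, max r₀ (max m₁ m₂) + 1, by omega,
    fun b r a hb hr ha hra h0 h67 => ?_⟩
  have hr₀r : r₀ ≤ r := by omega
  have hm₁a : m₁ ≤ a := by omega
  have hm₂a : m₂ ≤ a := by omega
  -- the four lower bounds
  obtain ⟨eE, -⟩ := hT b r (2 * a) (by rw [hb]) (by rw [hb]; norm_num) hr₀r (by omega)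
  have eE' : cT * ((r : ℝ) / (2 * a)) ^ (1 / 3 : ℝ) ≤ (μ).real E[b, (r : ℤ), 2 * (a : ℤ)] := by
    have e1 : ((2 * a : ℕ) : ℝ) = 2 * (a : ℝ) := by push_cast; ring
    have e2 : ((2 * a : ℕ) : ℤ) = 2 * (a : ℤ) := by push_cast; ring
    rw [e1, e2] at eE
    exact eE
  have eR : c₁ ≤ (μ).real TB[col b + a, col b + 2 * a, 0, 2 * a] := by
    have := h₁ a hm₁a (col b + a) 0 (2 * a) (by omega) le_rfl
    rw [zero_add] at this
    convert this using 4; ring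
  have eL : c₁ ≤ (μ).real TB[col b - 2 * a, col b - a, 0, 2 * a] := by
    have := h₁ a hm₁a (col b - 2 * a) 0 (2 * a) (by omega) le_rfl
    rw [zero_add] at this
    convert this using 4; ring
  have eH : c₂ ≤ (μ).real LR[(a : ℤ), col b + 2 * a, a, 2 * a] := by
    have := h₂ a hm₂a a a (col b + a) h0 h67
    convert this using 4 <;> ring
  -- Harris–FKG
  have finA := HalfPlaneArm.ann_finite (X := col) (Y := hgtOf) HalfPlaneArm.diag_injective
  have finB := HalfPlaneArm.box_finite (X := col) (Y := hgtOf) HalfPlaneArm.diag_injective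
  have mE : MeasurableSet (E[b, (r : ℤ), 2 * (a : ℤ)]) :=
    HalfPlaneArm.measurableSet_openCrossing_of_finite (finA b _ _) _ _
  have mTB : ∀ A₁ A₂ B₁ B₂ : ℤ, MeasurableSet (TB[A₁, A₂, B₁, B₂]) := fun _ _ _ _ =>
    HalfPlaneArm.measurableSet_openCrossing_of_finite (finB _ _ _ _) _ _
  have mLR : ∀ A₁ A₂ B₁ B₂ : ℤ, MeasurableSet (LR[A₁, A₂, B₁, B₂]) := fun _ _ _ _ =>
    HalfPlaneArm.measurableSet_openCrossing_of_finite (finB _ _ _ _) _ _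
  have h3 := HalfPlaneArm.harris₃ half (isUpperSet_openCrossing _ _ _) (isUpperSet_openCrossing _ _ _)
    (isUpperSet_openCrossing _ _ _) mE (mTB (col b + a) (col b + 2 * a) 0 (2 * a))
    (mTB (col b - 2 * a) (col b - a) 0 (2 * a))
  have h4 := harris_fkg_holds (zdGraph 2) half
    (((isUpperSet_openCrossing _ _ _).inter (isUpperSet_openCrossing _ _ _)).inter
      (isUpperSet_openCrossing _ _ _)) (isUpperSet_openCrossing _ _ _)
    ((mE.inter (mTB (col b + a) (col b + 2 * a) 0 (2 * a))).inter
      (mTB (col b - 2 * a) (col b - a) 0 (2 * a))) (mLR a (col b + 2 * a) a (2 * a))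
  have hx0 : 0 ≤ ((r : ℝ) / (2 * a)) ^ (1 / 3 : ℝ) := by positivity
  calc cT * c₁ * c₁ * c₂ * ((r : ℝ) / (2 * a)) ^ (1 / 3 : ℝ)
      = cT * ((r : ℝ) / (2 * a)) ^ (1 / 3 : ℝ) * c₁ * c₁ * c₂ := by ring
    _ ≤ (μ).real E[b, (r : ℤ), 2 * (a : ℤ)] * (μ).real TB[col b + a, col b + 2 * a, 0, 2 * a] *
          (μ).real TB[col b - 2 * a, col b - a, 0, 2 * a] *
          (μ).real LR[(a : ℤ), col b + 2 * a, a, 2 * a] := by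
        gcongr
    _ ≤ (μ).real (E[b, (r : ℤ), 2 * (a : ℤ)] ∩ TB[col b + a, col b + 2 * a, 0, 2 * a] ∩
          TB[col b - 2 * a, col b - a, 0, 2 * a]) *
          (μ).real LR[(a : ℤ), col b + 2 * a, a, 2 * a] :=
        mul_le_mul_of_nonneg_right h3 measureReal_nonneg
    _ ≤ _ := h4

end Summit.CriticalPhenomena.CardyFormulaZ2.Theorems.SymmetryUpgradeR.SwallowingSkeleton

end
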